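import Summits.QuantumFields.YangMills.Theorems.UnitScaleTiltProp8LinAvgFluxExact
import Summits.QuantumFields.YangMills.Theorems.UnitScaleTiltProp7HolRatioPerStep
import HarnessLib

/-!
# Crux `HistoryTailL` (stmt-QuantumFields-19936) — THE (0.4) EML AVERAGE IS FLUX-LINEAR TO SECOND ORDER:
# [Balaban1985Averaging] Prop. 1 (51) for the averaging of record IN SHARP FORM, WITH THE LINEAR TERM IDENTIFIED
# (brick (M1) of the LOCATE «B3» for the capped sweep stub `stub_sandwichSweepGapCapped` of the ledger skeleton v5
# `Cruxes/HistoryTailL/Lines/sandwich_discharge.lean`; text-independent of that stub — a property of Bałaban's average alone)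

Cell `ym3-torus` (YM ladder rung R3 = continuum SU(2) Yang–Mills on the three-torus; NOT the Clay problem), width seat `ym-ust-19936-w5` gen 13.

THE STATEMENT (§3 `norm_plaqHol_avgFun_sub_one_sub_fluxes_le`).  Let `U` be an `SU(N)` lattice gauge field on `T^{(j)}` in the flat small-field chart,
`‖U_b − 1‖ ≤ δ` for every bond, with `16ℓδ ≤ 1` and `2ℓδ < δ_N` (`ℓ = (d+2)L`, the guards of the one-step linearisation).  Then for every coarse plaquette
`p′ = (y; μ, ν)` of `T^{(j+1)}` the plaquette variable of the one-step (0.4) average `Ū = avgFun expMeanLogSU U` ([Balaban1987RG1] (0.4)) satisfies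

  `‖(Ū(∂p′) − 1) − L·L^{−(d+1)}·Σ_{x ∈ B(y)} Σ_{s,t<L} Y(∂□(x + se_μ + te_ν))‖ ≤ 1377·(ℓδ)²`,   `Y = U − 1`,

i.e. the coarse plaquette deviation IS, to second order in `ℓδ`, `L²` times the MEAN of the `L^d·L²` fine plaquette circulations of the translated-square family
— the linear term of [Balaban1985Averaging] Prop. 1 (51) («`|Ū(∂p′) − 1| ≤ L²α₀ + C₀(L²α₀)²`») made explicit.  Corollaries: §3 `norm_plaqHol_avgFun_sub_one_le_sharp`
(the sharp (51): `‖Ū(∂p′) − 1‖ ≤ L²·f + 1377(ℓδ)²` when every fine circulation has `‖Y(∂□)‖ ≤ f`), and §2 `norm_plaqHol_sub_one_sub_circulation_le` (a fine plaquette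
variable is its circulation to second order: `‖(U(∂□) − 1) − Y(∂□)‖ ≤ 13δ²`).

THE PROOF (assembly over tree theorems).  `Z_c := Ū(c) − 1`: by ✓`BlockAveragingEMLLinearised.norm_avgFun_sub_one_sub_linAvg_le` (Prop. 3 at the flat background,
PROVED) `‖Z_c − (Q₁Y)(c)‖ ≤ 81(ℓδ)²`, and `‖(Q₁Y)(c)‖ ≤ 3ℓδ` (three walks of `≤ ℓ` steps), so `‖Z_c‖ ≤ 9ℓδ =: t`; the plaquette is
`(1+Z₁)(1+Z₂)(1+Z₃)⁻¹(1+Z₄)⁻¹` with `‖(1+Z)⁻¹ − 1 + Z‖ ≤ ‖Z‖²` (unitarity) and `‖Π(1+a_i) − 1 − Σa_i‖ ≤ 6t² + 4t³ + t⁴` (§1), whence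
`‖(Ū(∂p′) − 1) − (Q₁Y(c₁) + Q₁Y(c₂) − Q₁Y(c₃) − Q₁Y(c₄))‖ ≤ 13t² + 4·81(ℓδ)² ≤ 1377(ℓδ)²`; finally the FLUX EXACTNESS of the linearised average
✓`LinAvgFluxExact.sum_linAvg_plaq_eq_fluxes` (the comb means cancel around a closed coarse plaquette; abelian lattice Stokes) rewrites the linear term.

WHAT THIS IS NOT.  One step, global flat chart; the LOCAL variant (hypothesis only on the footprint the four averages read), the `j`-fold iterate with re-gauging
((M2) of the LOCATE) and the `SU(2)` reading ((M3)) are not here; nothing of the capped sweep stub, `HistoryTailL` or the rung is proved.  YM₃ on T³ is rung R3,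
NOT the Clay problem.

References: T. Bałaban, CMP **98** (1985) 17–51 [Balaban1985Averaging] (Prop. 1 (51) p.26, Prop. 3 (122)–(125) p.36, (19)–(20) p.21); CMP **109** (1987) 249–301
[Balaban1987RG1] ((0.3)–(0.4) pp.252–253); CMP **95** (1984) 17–40 [Balaban1984PropagatorsI] ((1.8)–(1.11) p.19).
-/

noncomputable section

open scoped BigOperators Matrix.Norms.L2Operator

namespace Summit.QuantumFields.YangMills.Theorems.CovariantDischargeAvgPlaqFluxLinear

open Literature.MathematicalPhysics.QuantumFieldTheory.Balaban1983to89
open T4Continuum BlockAveraging BlockAveragingEMLLinearised LatticeFieldCalculus ExpMeanLog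
open Summit.QuantumFields.YangMills.Theorems.LinAvgFluxExact (sum_linAvg_plaq_eq_fluxes)
open Summit.QuantumFields.YangMills.Theorems.Prop7HolRatioPerStep (coe_star_mul_self norm_star_sub_one_eq)

/-! ## §1 Second-order letters in a normed ring and in `SU(N)` -/

section Algebra

variable {𝔸 : Type*} [NormedRing 𝔸]

/-- FOUR NEAR-IDENTITY FACTORS TO FIRST ORDER: `‖(1+a)(1+b)(1+c)(1+d) − 1 − (a+b+c+d)‖ ≤ 6t² + 4t³ + t⁴` when every `‖·‖ ≤ t` (the eleven ordered products
of two, three and four of the letters). [folklore] -/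
theorem norm_four_prod_sub_one_sub_sum_le {a b c d : 𝔸} {t : ℝ} (ht : 0 ≤ t) (ha : ‖a‖ ≤ t) (hb : ‖b‖ ≤ t) (hc : ‖c‖ ≤ t) (hd : ‖d‖ ≤ t) :
    ‖(1 + a) * (1 + b) * (1 + c) * (1 + d) - 1 - (a + b + c + d)‖ ≤ 6 * t ^ 2 + 4 * t ^ 3 + t ^ 4 := by
  have e : (1 + a) * (1 + b) * (1 + c) * (1 + d) - 1 - (a + b + c + d) =
      (a * b + a * c + a * d + b * c + b * d + c * d) + (a * b * c + a * b * d + a * c * d + b * c * d) + a * b * c * d := by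
    noncomm_ring
  rw [e]
  have h2 : ∀ x y : 𝔸, ‖x‖ ≤ t → ‖y‖ ≤ t → ‖x * y‖ ≤ t ^ 2 := fun x y hx hy =>
    (norm_mul_le _ _).trans (by rw [sq]; exact mul_le_mul hx hy (norm_nonneg _) ht)
  have h3 : ∀ x y z : 𝔸, ‖x‖ ≤ t → ‖y‖ ≤ t → ‖z‖ ≤ t → ‖x * y * z‖ ≤ t ^ 3 := fun x y z hx hy hz =>
    (norm_mul_le _ _).trans (by
      rw [pow_succ]; exact mul_le_mul (h2 x y hx hy) hz (norm_nonneg _) (by positivity))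
  have h4 : ‖a * b * c * d‖ ≤ t ^ 4 :=
    (norm_mul_le _ _).trans (by
      rw [pow_succ]; exact mul_le_mul (h3 a b c ha hb hc) hd (norm_nonneg _) (by positivity))
  have hpairs : ‖a * b + a * c + a * d + b * c + b * d + c * d‖ ≤ 6 * t ^ 2 := by
    have := h2 a b ha hb; have := h2 a c ha hc; have := h2 a d ha hd
    have := h2 b c hb hc; have := h2 b d hb hd; have := h2 c d hc hd
    calc ‖a * b + a * c + a * d + b * c + b * d + c * d‖
        ≤ ‖a * b‖ + ‖a * c‖ + ‖a * d‖ + ‖b * c‖ + ‖b * d‖ + ‖c * d‖ := by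
          refine (norm_add_le _ _).trans (add_le_add ?_ le_rfl)
          refine (norm_add_le _ _).trans (add_le_add ?_ le_rfl)
          refine (norm_add_le _ _).trans (add_le_add ?_ le_rfl)
          refine (norm_add_le _ _).trans (add_le_add ?_ le_rfl)
          exact norm_add_le _ _
      _ ≤ 6 * t ^ 2 := by linarith
  have htriples : ‖a * b * c + a * b * d + a * c * d + b * c * d‖ ≤ 4 * t ^ 3 := by
    have := h3 a b c ha hb hc; have := h3 a b d ha hb hd; have := h3 a c d ha hc hd; have := h3 b c d hb hc hd
    calc ‖a * b * c + a * b * d + a * c * d + b * c * d‖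
        ≤ ‖a * b * c‖ + ‖a * b * d‖ + ‖a * c * d‖ + ‖b * c * d‖ := by
          refine (norm_add_le _ _).trans (add_le_add ?_ le_rfl)
          refine (norm_add_le _ _).trans (add_le_add ?_ le_rfl)
          exact norm_add_le _ _
      _ ≤ 4 * t ^ 3 := by linarith
  calc ‖(a * b + a * c + a * d + b * c + b * d + c * d) + (a * b * c + a * b * d + a * c * d + b * c * d) + a * b * c * d‖
      ≤ ‖a * b + a * c + a * d + b * c + b * d + c * d‖ + ‖a * b * c + a * b * d + a * c * d + b * c * d‖ + ‖a * b * c * d‖ :=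
        (norm_add_le _ _).trans (add_le_add (norm_add_le _ _) le_rfl)
    _ ≤ 6 * t ^ 2 + 4 * t ^ 3 + t ^ 4 := by linarith

end Algebra

section Unitary

variable {n : Type*} [Fintype n] [DecidableEq n] [Nonempty n]

/-- **THE INVERSE TO SECOND ORDER**: `‖g* − 1 + (g − 1)‖ ≤ ‖g − 1‖²` for `g ∈ SU(N)` (`g* − 1 + (g − 1) = −(g* − 1)(g − 1)`). [folklore] -/
theorem norm_star_sub_one_add_le (g : Matrix.specialUnitaryGroup n ℂ) :
    ‖star (g : Matrix n n ℂ) - 1 + ((g : Matrix n n ℂ) - 1)‖ ≤ ‖(g : Matrix n n ℂ) - 1‖ ^ 2 := by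
  have e : star (g : Matrix n n ℂ) - 1 + ((g : Matrix n n ℂ) - 1) = -((star (g : Matrix n n ℂ) - 1) * ((g : Matrix n n ℂ) - 1)) := by
    have h := coe_star_mul_self g
    have e1 : (star (g : Matrix n n ℂ) - 1) * ((g : Matrix n n ℂ) - 1) =
        star (g : Matrix n n ℂ) * (g : Matrix n n ℂ) - star (g : Matrix n n ℂ) - (g : Matrix n n ℂ) + 1 := by noncomm_ring
    rw [e1, h]; noncomm_ring
  rw [e, norm_neg]
  calc ‖(star (g : Matrix n n ℂ) - 1) * ((g : Matrix n n ℂ) - 1)‖ ≤ ‖star (g : Matrix n n ℂ) - 1‖ * ‖(g : Matrix n n ℂ) - 1‖ := norm_mul_le _ _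
    _ = ‖(g : Matrix n n ℂ) - 1‖ ^ 2 := by rw [norm_star_sub_one_eq, sq]

/-- **A PLAQUETTE OF NEAR-IDENTITY BONDS TO FIRST ORDER**: for `A, B, C, D ∈ SU(N)` within `t ≤ 1` of `1`,
`‖(A·B·C⁻¹·D⁻¹ − 1) − ((A−1) + (B−1) − (C−1) − (D−1))‖ ≤ 13t²`. [cite: Balaban1985Averaging, (19)-(20) p.21] -/
theorem norm_plaq_four_sub_one_sub_lin_le (A B C D : Matrix.specialUnitaryGroup n ℂ) {t : ℝ} (ht0 : 0 ≤ t) (ht1 : t ≤ 1)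
    (hA : ‖(A : Matrix n n ℂ) - 1‖ ≤ t) (hB : ‖(B : Matrix n n ℂ) - 1‖ ≤ t) (hC : ‖(C : Matrix n n ℂ) - 1‖ ≤ t) (hD : ‖(D : Matrix n n ℂ) - 1‖ ≤ t) :
    ‖((A * B * C⁻¹ * D⁻¹ : Matrix.specialUnitaryGroup n ℂ) : Matrix n n ℂ) - 1 -
        (((A : Matrix n n ℂ) - 1) + ((B : Matrix n n ℂ) - 1) - ((C : Matrix n n ℂ) - 1) - ((D : Matrix n n ℂ) - 1))‖ ≤ 13 * t ^ 2 := by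
  -- letters
  set a : Matrix n n ℂ := (A : Matrix n n ℂ) - 1 with ha
  set b : Matrix n n ℂ := (B : Matrix n n ℂ) - 1 with hb
  set c : Matrix n n ℂ := star (C : Matrix n n ℂ) - 1 with hc
  set d : Matrix n n ℂ := star (D : Matrix n n ℂ) - 1 with hd
  have hc' : ‖c‖ ≤ t := by rw [hc, norm_star_sub_one_eq]; exact hC
  have hd' : ‖d‖ ≤ t := by rw [hd, norm_star_sub_one_eq]; exact hD
  -- the product in the four letters
  have hprod : ((A * B * C⁻¹ * D⁻¹ : Matrix.specialUnitaryGroup n ℂ) : Matrix n n ℂ) = (1 + a) * (1 + b) * (1 + c) * (1 + d) := by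
    rw [Submonoid.coe_mul, Submonoid.coe_mul, Submonoid.coe_mul, ha, hb, hc, hd,
      show ((C⁻¹ : Matrix.specialUnitaryGroup n ℂ) : Matrix n n ℂ) = star (C : Matrix n n ℂ) from rfl,
      show ((D⁻¹ : Matrix.specialUnitaryGroup n ℂ) : Matrix n n ℂ) = star (D : Matrix n n ℂ) from rfl]
    noncomm_ring
  -- first order of the product
  have h1 := norm_four_prod_sub_one_sub_sum_le ht0 hA hB hc' hd'
  -- the two inverses to second order
  have hCi : ‖c + ((C : Matrix n n ℂ) - 1)‖ ≤ t ^ 2 :=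
    (norm_star_sub_one_add_le C).trans (pow_le_pow_left₀ (norm_nonneg _) hC 2)
  have hDi : ‖d + ((D : Matrix n n ℂ) - 1)‖ ≤ t ^ 2 :=
    (norm_star_sub_one_add_le D).trans (pow_le_pow_left₀ (norm_nonneg _) hD 2)
  have e : ((A * B * C⁻¹ * D⁻¹ : Matrix.specialUnitaryGroup n ℂ) : Matrix n n ℂ) - 1 -
      (((A : Matrix n n ℂ) - 1) + ((B : Matrix n n ℂ) - 1) - ((C : Matrix n n ℂ) - 1) - ((D : Matrix n n ℂ) - 1)) =
      ((1 + a) * (1 + b) * (1 + c) * (1 + d) - 1 - (a + b + c + d)) + (c + ((C : Matrix n n ℂ) - 1)) + (d + ((D : Matrix n n ℂ) - 1)) := by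
    rw [hprod, ha, hb]; abel
  rw [e]
  have ht2 : t ^ 3 ≤ t ^ 2 := by
    rw [pow_succ]; exact mul_le_of_le_one_right (by positivity) ht1
  have ht4 : t ^ 4 ≤ t ^ 2 := by
    have : t ^ 4 = t ^ 2 * t ^ 2 := by ring
    rw [this]; exact mul_le_of_le_one_right (by positivity) (by nlinarith)
  calc ‖((1 + a) * (1 + b) * (1 + c) * (1 + d) - 1 - (a + b + c + d)) + (c + ((C : Matrix n n ℂ) - 1)) + (d + ((D : Matrix n n ℂ) - 1))‖
      ≤ ‖(1 + a) * (1 + b) * (1 + c) * (1 + d) - 1 - (a + b + c + d)‖ + ‖c + ((C : Matrix n n ℂ) - 1)‖ + ‖d + ((D : Matrix n n ℂ) - 1)‖ :=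
        (norm_add_le _ _).trans (add_le_add (norm_add_le _ _) le_rfl)
    _ ≤ (6 * t ^ 2 + 4 * t ^ 3 + t ^ 4) + t ^ 2 + t ^ 2 := by linarith
    _ ≤ 13 * t ^ 2 := by linarith

end Unitary

/-! ## §2 Walk sums, the linearised average, and a fine plaquette to first order -/

section Fine

variable {n : Type*} [Fintype n] [DecidableEq n] [Nonempty n] {P : Params} {j : ℕ}

omit [Nonempty n] in
/-- `‖Y(Γ)‖ ≤ |Γ|·δ` when every bond variable has `‖Y_b‖ ≤ δ`. [cite: Balaban1984PropagatorsI, (1.8) p.19] -/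
theorem norm_walkSum_le (Y : PBond P j → Matrix n n ℂ) {δ : ℝ} (hY : ∀ b, ‖Y b‖ ≤ δ) :
    ∀ γ : List (LStep P j), ‖walkSum Y γ‖ ≤ γ.length * δ
  | [] => by simp
  | s :: γ => by
    rw [walkSum_cons, List.length_cons, Nat.cast_succ, add_mul, one_mul, add_comm ((γ.length : ℝ) * δ)]
    refine (norm_add_le _ _).trans (add_le_add ?_ (norm_walkSum_le Y hY γ))
    cases s.fwd
    · simpa using hY s.bond
    · simpa using hY s.bond

omit [Nonempty n] in
/-- `‖(Q₁Y)(c)‖ ≤ 3ℓδ` (`ℓ = (d+2)L`): the linearised (0.4) average is a mean of three walk sums of at most `ℓ` steps each.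
[cite: Balaban1985Averaging, (124)-(125) p.36] -/
theorem norm_linAvg_le (Y : PBond P j → Matrix n n ℂ) {δ : ℝ} (hδ : 0 ≤ δ) (hY : ∀ b, ‖Y b‖ ≤ δ) (c : PBond P (j + 1)) :
    ‖linAvg Y c‖ ≤ 3 * ((((P.d + 2) * P.L : ℕ) : ℝ) * δ) := by
  set ℓ : ℝ := (((P.d + 2) * P.L : ℕ) : ℝ) with hℓ
  have hℓ0 : 0 ≤ ℓ := Nat.cast_nonneg _
  -- each of the three walk sums is at most `ℓδ`
  have hw : ∀ (x : Site P j) (w : List (Letter P.d)), (walk x w).length ≤ (P.d + 2) * P.L → ‖walkSum Y (walk x w)‖ ≤ ℓ * δ := by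
    intro x w hlen
    refine (norm_walkSum_le Y hY _).trans ?_
    exact mul_le_mul_of_nonneg_right (by rw [hℓ]; exact_mod_cast hlen) hδ
  have hterm : ∀ i : Idx P,
      ‖walkSum Y (walk (emb c.src) (stairWord i.2.1 (off i.1))) +
          walkSum Y (walk (walkEnd (emb c.src) (stairWord i.2.1 (off i.1))) (List.replicate P.L (c.dir, true))) -
          walkSum Y (walk (emb c.tgt) (stairWord i.2.2 (off i.1)))‖ ≤ 3 * (ℓ * δ) := by
    intro i
    have h1 := hw (emb c.src) _ (length_walk_stairWord_le (emb c.src) i.2.1 i.1)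
    have h2 := hw (walkEnd (emb c.src) (stairWord i.2.1 (off i.1))) _
      (length_walk_replicate_le (walkEnd (emb c.src) (stairWord i.2.1 (off i.1))) c.dir true)
    have h3 := hw (emb c.tgt) _ (length_walk_stairWord_le (emb c.tgt) i.2.2 i.1)
    calc _ ≤ ‖walkSum Y (walk (emb c.src) (stairWord i.2.1 (off i.1))) +
          walkSum Y (walk (walkEnd (emb c.src) (stairWord i.2.1 (off i.1))) (List.replicate P.L (c.dir, true)))‖ +
          ‖walkSum Y (walk (emb c.tgt) (stairWord i.2.2 (off i.1)))‖ := norm_sub_le _ _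
      _ ≤ (ℓ * δ + ℓ * δ) + ℓ * δ := add_le_add ((norm_add_le _ _).trans (add_le_add h1 h2)) h3
      _ = 3 * (ℓ * δ) := by ring
  rw [linAvg_def]
  have hcard : 0 < (Fintype.card (Idx P) : ℝ) := Nat.cast_pos.mpr Fintype.card_pos
  calc ‖((Fintype.card (Idx P) : ℂ))⁻¹ • ∑ i : Idx P,
        (walkSum Y (walk (emb c.src) (stairWord i.2.1 (off i.1))) +
          walkSum Y (walk (walkEnd (emb c.src) (stairWord i.2.1 (off i.1))) (List.replicate P.L (c.dir, true))) -
          walkSum Y (walk (emb c.tgt) (stairWord i.2.2 (off i.1))))‖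
      ≤ ‖((Fintype.card (Idx P) : ℂ))⁻¹‖ * ∑ i : Idx P, 3 * (ℓ * δ) := by
        refine (norm_smul_le _ _).trans (mul_le_mul_of_nonneg_left ((norm_sum_le _ _).trans (Finset.sum_le_sum fun i _ => hterm i))
          (norm_nonneg _))
    _ = 3 * (ℓ * δ) := by
        rw [Finset.sum_const, Finset.card_univ, nsmul_eq_mul, norm_inv, Complex.norm_natCast]
        field_simp

/-- **A FINE PLAQUETTE VARIABLE IS ITS CIRCULATION TO SECOND ORDER**: `‖(U(∂□) − 1) − (Y_{b₁} + Y_{b₂} − Y_{b₃} − Y_{b₄})‖ ≤ 13δ²` for `‖U_b − 1‖ ≤ δ ≤ 1`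
(`Y = U − 1`; the four bonds of `□ = (x; μ, ν)` in the order of `plaqHol`). [cite: Balaban1985Averaging, (19)-(20) p.21] -/
theorem norm_plaqHol_sub_one_sub_circulation_le (U : GaugeField P j (Matrix.specialUnitaryGroup n ℂ)) {δ : ℝ} (hδ : 0 ≤ δ) (hδ1 : δ ≤ 1)
    (hU : ∀ b, ‖((U b : Matrix.specialUnitaryGroup n ℂ) : Matrix n n ℂ) - 1‖ ≤ δ) (p : Plaq P j) :
    ‖((GaugeField.plaqHol U p : Matrix.specialUnitaryGroup n ℂ) : Matrix n n ℂ) - 1 -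
        ((((U ⟨p.src, p.μ⟩ : Matrix.specialUnitaryGroup n ℂ) : Matrix n n ℂ) - 1) +
          (((U ⟨p.src.shift p.μ, p.ν⟩ : Matrix.specialUnitaryGroup n ℂ) : Matrix n n ℂ) - 1) -
          (((U ⟨p.src.shift p.ν, p.μ⟩ : Matrix.specialUnitaryGroup n ℂ) : Matrix n n ℂ) - 1) -
          (((U ⟨p.src, p.ν⟩ : Matrix.specialUnitaryGroup n ℂ) : Matrix n n ℂ) - 1))‖ ≤ 13 * δ ^ 2 :=
  norm_plaq_four_sub_one_sub_lin_le _ _ _ _ hδ hδ1 (hU _) (hU _) (hU _) (hU _)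

end Fine

/-! ## §3 The coarse plaquette of the (0.4) average to first order: the linear term is the flux mean -/

section Main

variable {n : Type*} [Fintype n] [DecidableEq n] [Nonempty n] {P : Params} {j : ℕ}

/-- **THE COARSE PLAQUETTE OF THE ONE-STEP (0.4) AVERAGE TO FIRST ORDER, LINEARISED-AVERAGE FORM**: in the flat small-field chart `‖U_b − 1‖ ≤ δ`
(`16ℓδ ≤ 1`, `2ℓδ < δ_N`), for every coarse plaquette `p′`:
`‖(Ū(∂p′) − 1) − (Q₁Y(c₁) + Q₁Y(c₂) − Q₁Y(c₃) − Q₁Y(c₄))‖ ≤ 1377·(ℓδ)²` (`c₁…c₄` the four bonds of `p′` in the order of `plaqHol`, `Q₁ = linAvg`, `Y = U − 1`).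
[cite: Balaban1985Averaging, Prop. 3 (122)-(125) p.36 and Prop. 1 (51) p.26; Balaban1987RG1, (0.4) p.253] -/
theorem norm_plaqHol_avgFun_sub_one_sub_linAvg_le (U : GaugeField P j (Matrix.specialUnitaryGroup n ℂ)) {δ : ℝ} (hδ : 0 ≤ δ)
    (hU : ∀ b, ‖((U b : Matrix.specialUnitaryGroup n ℂ) : Matrix n n ℂ) - 1‖ ≤ δ)
    (h16 : 16 * ((((P.d + 2) * P.L : ℕ) : ℝ) * δ) ≤ 1) (hN : 2 * ((((P.d + 2) * P.L : ℕ) : ℝ) * δ) < deltaSU n)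
    (p' : Plaq P (j + 1)) :
    ‖((GaugeField.plaqHol (avgFun (expMeanLogSU (n := n)) U) p' : Matrix.specialUnitaryGroup n ℂ) : Matrix n n ℂ) - 1 -
        (linAvg (fun b => ((U b : Matrix.specialUnitaryGroup n ℂ) : Matrix n n ℂ) - 1) ⟨p'.src, p'.μ⟩ +
          linAvg (fun b => ((U b : Matrix.specialUnitaryGroup n ℂ) : Matrix n n ℂ) - 1) ⟨p'.src.shift p'.μ, p'.ν⟩ -
          linAvg (fun b => ((U b : Matrix.specialUnitaryGroup n ℂ) : Matrix n n ℂ) - 1) ⟨p'.src.shift p'.ν, p'.μ⟩ -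
          linAvg (fun b => ((U b : Matrix.specialUnitaryGroup n ℂ) : Matrix n n ℂ) - 1) ⟨p'.src, p'.ν⟩)‖ ≤
      1377 * ((((P.d + 2) * P.L : ℕ) : ℝ) * δ) ^ 2 := by
  -- letters
  set ℓδ : ℝ := (((P.d + 2) * P.L : ℕ) : ℝ) * δ with hℓδ
  have hℓδ0 : 0 ≤ ℓδ := mul_nonneg (Nat.cast_nonneg _) hδ
  have hℓδ16 : ℓδ ≤ 1 / 16 := by linarith
  set Y : PBond P j → Matrix n n ℂ := fun b => ((U b : Matrix.specialUnitaryGroup n ℂ) : Matrix n n ℂ) - 1 with hY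
  set V : GaugeField P (j + 1) (Matrix.specialUnitaryGroup n ℂ) := avgFun (expMeanLogSU (n := n)) U with hV
  -- the one-step linearisation at every coarse bond (tree: Prop. 3 at the flat background)
  have hlin : ∀ c : PBond P (j + 1), ‖((V c : Matrix.specialUnitaryGroup n ℂ) : Matrix n n ℂ) - 1 - linAvg Y c‖ ≤ 81 * ℓδ ^ 2 :=
    fun c => norm_avgFun_sub_one_sub_linAvg_le U hδ hU h16 hN c
  -- the size of the averaged bond variables: `t := 9ℓδ`
  set t : ℝ := 9 * ℓδ with ht
  have ht0 : 0 ≤ t := by positivity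
  have ht1 : t ≤ 1 := by rw [ht]; linarith
  have hZ : ∀ c : PBond P (j + 1), ‖((V c : Matrix.specialUnitaryGroup n ℂ) : Matrix n n ℂ) - 1‖ ≤ t := by
    intro c
    have h1 := hlin c
    have h2 : ‖linAvg Y c‖ ≤ 3 * ℓδ := norm_linAvg_le Y hδ (fun b => hU b) c
    have h3 : ‖((V c : Matrix.specialUnitaryGroup n ℂ) : Matrix n n ℂ) - 1‖ ≤ ‖((V c : Matrix.specialUnitaryGroup n ℂ) : Matrix n n ℂ) - 1 - linAvg Y c‖ +
        ‖linAvg Y c‖ := by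
      have := norm_add_le (((V c : Matrix.specialUnitaryGroup n ℂ) : Matrix n n ℂ) - 1 - linAvg Y c) (linAvg Y c)
      rwa [sub_add_cancel] at this
    have h4 : 81 * ℓδ ^ 2 ≤ 6 * ℓδ := by nlinarith
    rw [ht]; linarith
  -- the plaquette of the averaged field to first order in the `Z_c`
  have hplaq := norm_plaq_four_sub_one_sub_lin_le (V ⟨p'.src, p'.μ⟩) (V ⟨p'.src.shift p'.μ, p'.ν⟩) (V ⟨p'.src.shift p'.ν, p'.μ⟩)
    (V ⟨p'.src, p'.ν⟩) ht0 ht1 (hZ _) (hZ _) (hZ _) (hZ _)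
  -- names for the four averaged bond variables, their linearisations and the plaquette
  set Z₁ : Matrix n n ℂ := ((V ⟨p'.src, p'.μ⟩ : Matrix.specialUnitaryGroup n ℂ) : Matrix n n ℂ) - 1 with hZ₁
  set Z₂ : Matrix n n ℂ := ((V ⟨p'.src.shift p'.μ, p'.ν⟩ : Matrix.specialUnitaryGroup n ℂ) : Matrix n n ℂ) - 1 with hZ₂
  set Z₃ : Matrix n n ℂ := ((V ⟨p'.src.shift p'.ν, p'.μ⟩ : Matrix.specialUnitaryGroup n ℂ) : Matrix n n ℂ) - 1 with hZ₃
  set Z₄ : Matrix n n ℂ := ((V ⟨p'.src, p'.ν⟩ : Matrix.specialUnitaryGroup n ℂ) : Matrix n n ℂ) - 1 with hZ₄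
  set Q₁ : Matrix n n ℂ := linAvg Y ⟨p'.src, p'.μ⟩ with hQ₁
  set Q₂ : Matrix n n ℂ := linAvg Y ⟨p'.src.shift p'.μ, p'.ν⟩ with hQ₂
  set Q₃ : Matrix n n ℂ := linAvg Y ⟨p'.src.shift p'.ν, p'.μ⟩ with hQ₃
  set Q₄ : Matrix n n ℂ := linAvg Y ⟨p'.src, p'.ν⟩ with hQ₄
  set Pl : Matrix n n ℂ := ((GaugeField.plaqHol V p' : Matrix.specialUnitaryGroup n ℂ) : Matrix n n ℂ) - 1 with hPl
  have hplaq' : ‖Pl - (Z₁ + Z₂ - Z₃ - Z₄)‖ ≤ 13 * t ^ 2 := by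
    have e0 : Pl - (Z₁ + Z₂ - Z₃ - Z₄) =
        ((GaugeField.plaqHol V p' : Matrix.specialUnitaryGroup n ℂ) : Matrix n n ℂ) - 1 - (Z₁ + Z₂ - Z₃ - Z₄) := by rw [hPl]
    rw [e0]
    exact hplaq
  have h₁ : ‖Z₁ - Q₁‖ ≤ 81 * ℓδ ^ 2 := hlin ⟨p'.src, p'.μ⟩
  have h₂ : ‖Z₂ - Q₂‖ ≤ 81 * ℓδ ^ 2 := hlin ⟨p'.src.shift p'.μ, p'.ν⟩
  have h₃ : ‖Z₃ - Q₃‖ ≤ 81 * ℓδ ^ 2 := hlin ⟨p'.src.shift p'.ν, p'.μ⟩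
  have h₄ : ‖Z₄ - Q₄‖ ≤ 81 * ℓδ ^ 2 := hlin ⟨p'.src, p'.ν⟩
  -- replace each `Z_c` by `Q₁Y(c)` at cost `81(ℓδ)²`
  have e : Pl - (Q₁ + Q₂ - Q₃ - Q₄) = (Pl - (Z₁ + Z₂ - Z₃ - Z₄)) + (((Z₁ - Q₁) + (Z₂ - Q₂)) - (Z₃ - Q₃) - (Z₄ - Q₄)) := by abel
  rw [e]
  have hsum4 : ‖((Z₁ - Q₁) + (Z₂ - Q₂)) - (Z₃ - Q₃) - (Z₄ - Q₄)‖ ≤ 4 * (81 * ℓδ ^ 2) := by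
    calc ‖((Z₁ - Q₁) + (Z₂ - Q₂)) - (Z₃ - Q₃) - (Z₄ - Q₄)‖
        ≤ ‖((Z₁ - Q₁) + (Z₂ - Q₂)) - (Z₃ - Q₃)‖ + ‖Z₄ - Q₄‖ := norm_sub_le _ _
      _ ≤ (‖(Z₁ - Q₁) + (Z₂ - Q₂)‖ + ‖Z₃ - Q₃‖) + ‖Z₄ - Q₄‖ := add_le_add (norm_sub_le _ _) le_rfl
      _ ≤ ((81 * ℓδ ^ 2 + 81 * ℓδ ^ 2) + 81 * ℓδ ^ 2) + 81 * ℓδ ^ 2 :=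
          add_le_add (add_le_add ((norm_add_le _ _).trans (add_le_add h₁ h₂)) h₃) h₄
      _ = 4 * (81 * ℓδ ^ 2) := by ring
  have ht2 : 13 * t ^ 2 = 1053 * ℓδ ^ 2 := by rw [ht]; ring
  calc ‖(Pl - (Z₁ + Z₂ - Z₃ - Z₄)) + (((Z₁ - Q₁) + (Z₂ - Q₂)) - (Z₃ - Q₃) - (Z₄ - Q₄))‖
      ≤ ‖Pl - (Z₁ + Z₂ - Z₃ - Z₄)‖ + ‖((Z₁ - Q₁) + (Z₂ - Q₂)) - (Z₃ - Q₃) - (Z₄ - Q₄)‖ := norm_add_le _ _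
    _ ≤ 13 * t ^ 2 + 4 * (81 * ℓδ ^ 2) := add_le_add hplaq' hsum4
    _ = 1377 * ℓδ ^ 2 := by rw [ht2]; ring

/-- ★★ **THE (0.4) EML AVERAGE IS FLUX-LINEAR TO SECOND ORDER — [Balaban1985Averaging] Prop. 1 (51) IN SHARP FORM WITH THE LINEAR TERM IDENTIFIED**:
in the flat small-field chart `‖U_b − 1‖ ≤ δ` (`16ℓδ ≤ 1`, `2ℓδ < δ_N`, standing range `j+1 ≤ m+K`), for every coarse plaquette `p′ = (y; μ, ν)`:
`‖(Ū(∂p′) − 1) − L·L^{−(d+1)}·Σ_{r} Σ_{s,t<L} Y(∂□(blockSite y r + se_μ + te_ν))‖ ≤ 1377·(ℓδ)²` — the coarse plaquette deviation is `L²` times the MEAN of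
the `L^d·L²` fine circulations of the translated-square family, to second order.  (The linearised-average form above + the flux exactness
✓`LinAvgFluxExact.sum_linAvg_plaq_eq_fluxes`: the comb means cancel around a closed coarse plaquette.)
[cite: Balaban1985Averaging, Prop. 1 (51) p.26 and Prop. 3 (124)-(125) p.36; Balaban1984PropagatorsI, (1.9)-(1.11) p.19] -/
theorem norm_plaqHol_avgFun_sub_one_sub_fluxes_le (hj : j + 1 ≤ P.m + P.K) (U : GaugeField P j (Matrix.specialUnitaryGroup n ℂ)) {δ : ℝ}
    (hδ : 0 ≤ δ) (hU : ∀ b, ‖((U b : Matrix.specialUnitaryGroup n ℂ) : Matrix n n ℂ) - 1‖ ≤ δ)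
    (h16 : 16 * ((((P.d + 2) * P.L : ℕ) : ℝ) * δ) ≤ 1) (hN : 2 * ((((P.d + 2) * P.L : ℕ) : ℝ) * δ) < deltaSU n)
    (p' : Plaq P (j + 1)) :
    ‖((GaugeField.plaqHol (avgFun (expMeanLogSU (n := n)) U) p' : Matrix.specialUnitaryGroup n ℂ) : Matrix n n ℂ) - 1 -
        ((P.L : ℕ) : ℂ) • ((((P.L : ℝ) ^ (P.d + 1))⁻¹) • ∑ r : Fin P.d → Fin P.L, ∑ s ∈ Finset.range P.L, ∑ t ∈ Finset.range P.L,
          ((((U ⟨runSite (runSite (Site.blockSite p'.src r) p'.μ s) p'.ν t, p'.μ⟩ : Matrix.specialUnitaryGroup n ℂ) : Matrix n n ℂ) - 1) +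
            (((U ⟨runSite (runSite (runSite (Site.blockSite p'.src r) p'.μ s) p'.ν t) p'.μ 1, p'.ν⟩ : Matrix.specialUnitaryGroup n ℂ) :
              Matrix n n ℂ) - 1) -
            (((U ⟨runSite (runSite (runSite (Site.blockSite p'.src r) p'.μ s) p'.ν t) p'.ν 1, p'.μ⟩ : Matrix.specialUnitaryGroup n ℂ) :
              Matrix n n ℂ) - 1) -
            (((U ⟨runSite (runSite (Site.blockSite p'.src r) p'.μ s) p'.ν t, p'.ν⟩ : Matrix.specialUnitaryGroup n ℂ) : Matrix n n ℂ) - 1)))‖ ≤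
      1377 * ((((P.d + 2) * P.L : ℕ) : ℝ) * δ) ^ 2 := by
  have h := norm_plaqHol_avgFun_sub_one_sub_linAvg_le U hδ hU h16 hN p'
  rwa [sum_linAvg_plaq_eq_fluxes hj (fun b => ((U b : Matrix.specialUnitaryGroup n ℂ) : Matrix n n ℂ) - 1) p'.src p'.μ p'.ν] at h

/-- ★ **THE SHARP (51)**: if moreover every fine circulation in the plane `(μ, ν)` has `‖Y(∂□)‖ ≤ f`, then `‖Ū(∂p′) − 1‖ ≤ L²·f + 1377·(ℓδ)²` — leading
coefficient EXACTLY the area `L²` (the tree's crude Prop 1 has `L² + 6ℓ²`). [cite: Balaban1985Averaging, Prop. 1 (51) p.26] -/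
theorem norm_plaqHol_avgFun_sub_one_le_sharp (hj : j + 1 ≤ P.m + P.K) (U : GaugeField P j (Matrix.specialUnitaryGroup n ℂ)) {δ f : ℝ}
    (hδ : 0 ≤ δ) (hU : ∀ b, ‖((U b : Matrix.specialUnitaryGroup n ℂ) : Matrix n n ℂ) - 1‖ ≤ δ)
    (h16 : 16 * ((((P.d + 2) * P.L : ℕ) : ℝ) * δ) ≤ 1) (hN : 2 * ((((P.d + 2) * P.L : ℕ) : ℝ) * δ) < deltaSU n)
    (p' : Plaq P (j + 1))
    (hf : ∀ z : Site P j, ‖((((U ⟨z, p'.μ⟩ : Matrix.specialUnitaryGroup n ℂ) : Matrix n n ℂ) - 1) +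
        (((U ⟨runSite z p'.μ 1, p'.ν⟩ : Matrix.specialUnitaryGroup n ℂ) : Matrix n n ℂ) - 1) -
        (((U ⟨runSite z p'.ν 1, p'.μ⟩ : Matrix.specialUnitaryGroup n ℂ) : Matrix n n ℂ) - 1) -
        (((U ⟨z, p'.ν⟩ : Matrix.specialUnitaryGroup n ℂ) : Matrix n n ℂ) - 1))‖ ≤ f) :
    ‖((GaugeField.plaqHol (avgFun (expMeanLogSU (n := n)) U) p' : Matrix.specialUnitaryGroup n ℂ) : Matrix n n ℂ) - 1‖ ≤
      (P.L : ℝ) ^ 2 * f + 1377 * ((((P.d + 2) * P.L : ℕ) : ℝ) * δ) ^ 2 := by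
  set Y : PBond P j → Matrix n n ℂ := fun b => ((U b : Matrix.specialUnitaryGroup n ℂ) : Matrix n n ℂ) - 1 with hY
  have h := norm_plaqHol_avgFun_sub_one_sub_linAvg_le U hδ hU h16 hN p'
  have hlin := Summit.QuantumFields.YangMills.Theorems.LinAvgFluxExact.norm_sum_linAvg_plaq_le hj Y p'.src p'.μ p'.ν hf
  have htri := norm_add_le
    (((GaugeField.plaqHol (avgFun (expMeanLogSU (n := n)) U) p' : Matrix.specialUnitaryGroup n ℂ) : Matrix n n ℂ) - 1 -
      (linAvg Y ⟨p'.src, p'.μ⟩ + linAvg Y ⟨p'.src.shift p'.μ, p'.ν⟩ - linAvg Y ⟨p'.src.shift p'.ν, p'.μ⟩ - linAvg Y ⟨p'.src, p'.ν⟩))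
    (linAvg Y ⟨p'.src, p'.μ⟩ + linAvg Y ⟨p'.src.shift p'.μ, p'.ν⟩ - linAvg Y ⟨p'.src.shift p'.ν, p'.μ⟩ - linAvg Y ⟨p'.src, p'.ν⟩)
  rw [sub_add_cancel] at htri
  linarith

end Main

end Summit.QuantumFields.YangMills.Theorems.CovariantDischargeAvgPlaqFluxLinear

end
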